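import Summits.CriticalPhenomena.PercolationContinuityZ3.Theorems.PercNearOneGluingNoHeavyLowerTailQuantitativeS5FloorGatesFirst
import HarnessLib

/-!
# ROW M2-R30 IN FULL: the explicit (S5) floor is complete for EVERY monotone functional at EVERY compatible rank

Support file (`--supports stmt-CriticalPhenomena-4575`), prover seat `prim-rate-mine-2` (lane prim-rate, constants-miner (c), BENCH row
M2-R41; `run/shared/lean/prim/prim-rate/prim-rate-mine-2/PROOFS.md` §P41).  No definitions, no named facts, no sorries; standard axioms.

Weights non-degenerate on their support `E`, in which every relay is joined to every other; relays `T`, observers `o ≠ v` off `T`; `F` monotone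
nonnegative; `r` injective on `T` and COMPATIBLE with the means `m_t = ∫ F(C_t)` (ties allowed); `x₁` its minimal relay; `FLOOR_F(r)` = the left
side of `CSH.s5dMargin_ge_sum_rankGain_add_isolatedFloor_of_lt_one_of_compat`.  The observer's pocket `K` = vertices joined to `o` by pairs of
`E` missing `T ∪ {v}`; its gates = relays `E`-adjacent to `K`.

* `CSH.floor_pos_of_gate_lt` — a gate `b` with `m_{x₁} < m_b`: `0 < FLOOR_F(r)` at the given rank (`γ_b·q_b > 0`; the `hm`-form of
  `CSH.floor_pos_of_adj`, no strictness elsewhere);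
* `CSH.exists_compat_rank_floor_pos` — **`0 < s5dMargin w T r [] o v F` ⟹ some compatible injective rank `r'` has `0 < FLOOR_F(r')`**:
  either a gate has a larger mean than `x₁` (then `r' = r`), or every gate has the minimal mean, and the GATES-FIRST rank
  `r' = r` on the gates, `r + (sup r + 1)` elsewhere, is injective, compatible, has the same margin (`CSH.s5dMargin_nil_eq_of_compat`) and a
  positive floor by `CSH.floor_pos_of_gatesFirst`;
* `CSH.s5dMargin_nil_pos_iff_exists_compat_rank_floor_pos_general` — **ROW M2-R30 AS TYPED: `0 < s5dMargin w T r [] o v F ↔ ∃ r'`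
  injective on `T`, `m(F)`-compatible, with `0 < FLOOR_F(r')`** (⟸: the kernel floor at `r'` and rank-freeness).

The strictly compatible case is `CSH.s5dMargin_nil_pos_iff_exists_rank_floor_pos_of_strict` (row M2-R40); the tie-first choice of the rank
is necessary at ties (refutations/M2-R22-TIE.json of the lane: a single tied gate ranked last kills the floor at that rank).
[cite: KozmaNitzan2024, Conj. 4 (p. 32)] [cite: Harris1960, Lemma 4.1 (p. 16)] [cite: VandenbergHaggstromKahn2005, §2.1 (pp. 9–13)]
-/

noncomputable section

namespace Summit.CriticalPhenomena.PercolationContinuityZ3.Theorems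

open MeasureTheory Set Literature.Probability.LatticeModels Literature.Probability.Percolation
open scoped Classical
open KNPreFKG

namespace CSH

variable {n : ℕ}

/-- **A gate of larger mean makes the floor positive at the given rank.**  Weights non-degenerate on the support `E`; `o ≠ v` off `T`;
`r` injective on `T` and compatible with the means of the monotone nonnegative `F`; a relay `x₁ ∈ T` and a relay `b ∈ T` with `m_{x₁} < m_b`,
joined to `x₁` in `(V, E)` and `E`-adjacent to a vertex `y` of the observer's pocket.  Then `0 < FLOOR_F(r)` (its summand `γ_b·q_b` is positive).
[cite: KozmaNitzan2024, Conj. 4 (p. 32)] [cite: Harris1960, Lemma 4.1 (p. 16)] -/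
theorem floor_pos_of_gate_lt (w : Sym2 (Fin n) → unitInterval) (E : Set (Sym2 (Fin n)))
    (hE0 : ∀ f, f ∉ E → (w f : ℝ) = 0) (hE1 : ∀ f ∈ E, 0 < (w f : ℝ) ∧ (w f : ℝ) < 1)
    (T : Finset (Fin n)) (r : Fin n → ℕ) (hr : Set.InjOn r ↑T) (x₁ : Fin n) (hx : x₁ ∈ T)
    (o v : Fin n) (hoT : o ∉ T) (hvT : v ∉ T) (hov : o ≠ v)
    (y b : Fin n) (hy : (openGraph {f | f ∈ E ∧ ∀ z ∈ f, z ∉ T ∧ z ≠ v}).Reachable o y) (hb : b ∈ T)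
    (hyb : s(y, b) ∈ E) (hbx₁ : (openGraph E).Reachable b x₁)
    (F : Set (Fin n) → ℝ) (hF : ∀ S S' : Set (Fin n), S ⊆ S' → F S ≤ F S') (hF0 : ∀ S : Set (Fin n), 0 ≤ F S)
    (hcompat : ∀ a ∈ T, ∀ a' ∈ T, r a < r a' →
      ∫ ω, F (openCluster ω a) ∂(prodBernoulli w) ≤ ∫ ω, F (openCluster ω a') ∂(prodBernoulli w))
    (hm : ∫ ω, F (openCluster ω x₁) ∂(prodBernoulli w) < ∫ ω, F (openCluster ω b) ∂(prodBernoulli w)) :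
    0 < ∑ a ∈ T, (rankGain w T r F a * avoidConst w a ((↑(T.erase a) : Set (Fin n)) ∪ ({d | d ∈ ([] : List (Fin n))} ∪ {v})) o +
        (∏ e ∈ Finset.univ.filter (fun e : Sym2 (Fin n) => ∃ y ∈ (↑(T.filter (fun b => r b < r a)) : Set (Fin n)), y ∈ e), (1 - (w e : ℝ))) *
          ((∫ η in ((⋃ t ∈ (insert a (T.filter (fun b => r a < r b) ∪ (([] : List (Fin n))).toFinset)), openConn o t) ∪ openConn o v),
              F {c | c = a ∨ ∃ e ∈ openEdgeCluster η a, c ∈ e}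
              ∂(prodBernoulli fun e => if (∃ y ∈ (↑(T.filter (fun b => r b < r a)) : Set (Fin n)), y ∈ e) then (0 : unitInterval) else w e)) -
            (prodBernoulli fun e => if (∃ y ∈ (↑(T.filter (fun b => r b < r a)) : Set (Fin n)), y ∈ e) then (0 : unitInterval) else w e).real
                ((⋃ t ∈ (insert a (T.filter (fun b => r a < r b) ∪ (([] : List (Fin n))).toFinset)), openConn o t) ∪ openConn o v) *
              (∫ η, F {c | c = a ∨ ∃ e ∈ openEdgeCluster η a, c ∈ e}
                ∂(prodBernoulli fun e => if (∃ y ∈ (↑(T.filter (fun b => r b < r a)) : Set (Fin n)), y ∈ e) then (0 : unitInterval) else w e)))) := by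
  have hγ : 0 < rankGain w T r F b := rankGain_pos_of_reachable_of_lt w E hE0 hE1 T r F hr hcompat b x₁ hb hx hm hbx₁
  have hq : 0 < avoidConst w b ((↑(T.erase b) : Set (Fin n)) ∪ ({d | d ∈ ([] : List (Fin n))} ∪ {v})) o :=
    avoidConst_pos_of_touching w E hE0 hE1 o v hov T hoT hvT b y hb hy hyb
  have hnn := fun a' (ha' : a' ∈ T) => isolatedFloor_term_nonneg w o v T r F hF hF0 hcompat a' ha'
  have hsingle := Finset.single_le_sum (fun a' ha' => add_nonneg (hnn a' ha').1 (hnn a' ha').2) hb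
  have hterm : 0 < rankGain w T r F b * avoidConst w b ((↑(T.erase b) : Set (Fin n)) ∪ ({d | d ∈ ([] : List (Fin n))} ∪ {v})) o :=
    mul_pos hγ hq
  linarith [(hnn b hb).2]

/-- **`0 < margin` ⟹ some compatible injective rank has a positive floor** (row M2-R30 ⟹, every monotone `F ≥ 0`, every compatible rank).
Weights non-degenerate on the support `E`, in which every relay is joined to the minimal relay `x₁` of `r`; `o ≠ v` off `T`; `r` injective on
`T`, compatible with the means of `F`.  The witness is `r` itself when some gate of the observer's pocket has a larger mean than `x₁`, and a
gates-first rearrangement of `r` otherwise. [cite: KozmaNitzan2024, Conj. 4 (p. 32)] [cite: Harris1960, Lemma 4.1 (p. 16)] -/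
theorem exists_compat_rank_floor_pos (w : Sym2 (Fin n) → unitInterval) (E : Set (Sym2 (Fin n)))
    (hE0 : ∀ f, f ∉ E → (w f : ℝ) = 0) (hE1 : ∀ f ∈ E, 0 < (w f : ℝ) ∧ (w f : ℝ) < 1)
    (T : Finset (Fin n)) (r : Fin n → ℕ) (hr : Set.InjOn r ↑T) (x₁ : Fin n) (hx : x₁ ∈ T) (hmin : ∀ t ∈ T, r x₁ ≤ r t)
    (hconn : ∀ b ∈ T, (openGraph E).Reachable b x₁)
    (o v : Fin n) (hoT : o ∉ T) (hvT : v ∉ T) (hov : o ≠ v)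
    (F : Set (Fin n) → ℝ) (hF : ∀ S S' : Set (Fin n), S ⊆ S' → F S ≤ F S') (hF0 : ∀ S : Set (Fin n), 0 ≤ F S)
    (hcompat : ∀ a ∈ T, ∀ a' ∈ T, r a < r a' →
      ∫ ω, F (openCluster ω a) ∂(prodBernoulli w) ≤ ∫ ω, F (openCluster ω a') ∂(prodBernoulli w))
    (hpos : 0 < s5dMargin w T r [] o v F) :
    ∃ r' : Fin n → ℕ, Set.InjOn r' ↑T ∧
      (∀ a ∈ T, ∀ a' ∈ T, r' a < r' a' →
        ∫ ω, F (openCluster ω a) ∂(prodBernoulli w) ≤ ∫ ω, F (openCluster ω a') ∂(prodBernoulli w)) ∧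
      0 < ∑ a ∈ T, (rankGain w T r' F a * avoidConst w a ((↑(T.erase a) : Set (Fin n)) ∪ ({d | d ∈ ([] : List (Fin n))} ∪ {v})) o +
        (∏ e ∈ Finset.univ.filter (fun e : Sym2 (Fin n) => ∃ y ∈ (↑(T.filter (fun b => r' b < r' a)) : Set (Fin n)), y ∈ e), (1 - (w e : ℝ))) *
          ((∫ η in ((⋃ t ∈ (insert a (T.filter (fun b => r' a < r' b) ∪ (([] : List (Fin n))).toFinset)), openConn o t) ∪ openConn o v),
              F {c | c = a ∨ ∃ e ∈ openEdgeCluster η a, c ∈ e}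
              ∂(prodBernoulli fun e => if (∃ y ∈ (↑(T.filter (fun b => r' b < r' a)) : Set (Fin n)), y ∈ e) then (0 : unitInterval) else w e)) -
            (prodBernoulli fun e => if (∃ y ∈ (↑(T.filter (fun b => r' b < r' a)) : Set (Fin n)), y ∈ e) then (0 : unitInterval) else w e).real
                ((⋃ t ∈ (insert a (T.filter (fun b => r' a < r' b) ∪ (([] : List (Fin n))).toFinset)), openConn o t) ∪ openConn o v) *
              (∫ η, F {c | c = a ∨ ∃ e ∈ openEdgeCluster η a, c ∈ e}
                ∂(prodBernoulli fun e => if (∃ y ∈ (↑(T.filter (fun b => r' b < r' a)) : Set (Fin n)), y ∈ e) then (0 : unitInterval) else w e)))) := by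
  -- the observer's pocket and its gates
  set E0 : Set (Sym2 (Fin n)) := {f | f ∈ E ∧ ∀ z ∈ f, z ∉ T ∧ z ≠ v} with hE0def
  set K : Set (Fin n) := {y | (openGraph E0).Reachable o y} with hKdef
  have hKprop : ∀ y ∈ K, y ∉ T ∧ y ≠ v := by
    intro y hy
    exact forall_reachable_of_edges (S := E0) (fun z => z ∉ T ∧ z ≠ v) ⟨hoT, hov⟩ (fun f hf z hz => hf.2 z hz) hy
  have hoK : o ∈ K := SimpleGraph.Reachable.refl _
  have hvK : v ∉ K := fun h => (hKprop v h).2 rfl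
  have hTK : ∀ t ∈ T, t ∉ K := fun t ht htK => (hKprop t htK).1 ht
  have hKconn : ∀ y ∈ K, (openGraph {f | f ∈ E ∧ ∀ z ∈ f, z ∈ K}).Reachable o y := by
    intro y hy
    obtain ⟨W⟩ := (show (openGraph E0).Reachable o y from hy)
    refine QuantBHK.reachable_of_walk_edges_subset W fun g hg => ⟨(QuantBHK.mem_and_not_isDiag_of_mem_edges W hg).1.1, fun z hz => ?_⟩
    exact (W.takeUntil z (SimpleGraph.Walk.mem_support_of_mem_edges hg hz)).reachable
  set X : Finset (Fin n) := T.filter (fun t => ∃ y, y ∈ K ∧ s(y, t) ∈ E) with hXdef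
  have hXT : ∀ g ∈ X, g ∈ T := fun g hg => (Finset.mem_filter.1 hg).1
  have hXadj : ∀ g ∈ X, ∃ y ∈ K, s(y, g) ∈ E := fun g hg => by
    obtain ⟨y, hyK, hyg⟩ := (Finset.mem_filter.1 hg).2
    exact ⟨y, hyK, hyg⟩
  have hKexit : ∀ p q : Fin n, s(p, q) ∈ E → p ∈ K → q ∈ K ∨ q = v ∨ q ∈ (↑X : Set (Fin n)) := by
    intro p q hpq hp
    by_cases hqv : q = v
    · exact Or.inr (Or.inl hqv)
    by_cases hqT : q ∈ T
    · exact Or.inr (Or.inr (Finset.mem_coe.2 (Finset.mem_filter.2 ⟨hqT, p, hp, hpq⟩)))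
    by_cases hpq' : p = q
    · exact Or.inl (hpq' ▸ hp)
    left
    have hadj : (openGraph E0).Adj p q := by
      rw [openGraph_adj]
      refine ⟨⟨hpq, fun z hz => ?_⟩, hpq'⟩
      rcases Sym2.mem_iff.1 hz with rfl | rfl
      · exact hKprop _ hp
      · exact ⟨hqT, hqv⟩
    exact SimpleGraph.Reachable.trans hp hadj.reachable
  -- the mean of `x₁` is minimal
  have hmx : ∀ t ∈ T, ∫ ω, F (openCluster ω x₁) ∂(prodBernoulli w) ≤ ∫ ω, F (openCluster ω t) ∂(prodBernoulli w) := by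
    intro t ht
    rcases (hmin t ht).lt_or_eq with hlt | heq
    · exact hcompat x₁ hx t ht hlt
    · rw [hr hx ht heq]
  by_cases hA : ∃ g ∈ X, ∫ ω, F (openCluster ω x₁) ∂(prodBernoulli w) < ∫ ω, F (openCluster ω g) ∂(prodBernoulli w)
  · -- a gate of larger mean: the given rank
    obtain ⟨g, hg, hm⟩ := hA
    obtain ⟨y, hyK, hyg⟩ := hXadj g hg
    exact ⟨r, hr, hcompat, floor_pos_of_gate_lt w E hE0 hE1 T r hr x₁ hx o v hoT hvT hov y g hyK (hXT g hg) hyg (hconn g (hXT g hg))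
      F hF hF0 hcompat hm⟩
  · -- every gate has the minimal mean: the gates-first rank
    push Not at hA
    set C : ℕ := T.sup r + 1 with hC
    have hle : ∀ t ∈ T, r t < C := fun t ht => Nat.lt_succ_of_le (Finset.le_sup ht)
    set rG : Fin n → ℕ := fun t => if t ∈ X then r t else r t + C with hrG
    have hrG_in : ∀ t ∈ X, rG t = r t := fun t ht => by simp only [hrG, if_pos ht]
    have hrG_out : ∀ t, t ∉ X → rG t = r t + C := fun t ht => by simp only [hrG, if_neg ht]
    have hrG : Set.InjOn rG ↑T := by
      intro a ha b hb hab
      have ha' := Finset.mem_coe.1 ha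
      have hb' := Finset.mem_coe.1 hb
      by_cases haX : a ∈ X <;> by_cases hbX : b ∈ X
      · rw [hrG_in a haX, hrG_in b hbX] at hab
        exact hr ha hb hab
      · rw [hrG_in a haX, hrG_out b hbX] at hab
        have := hle a ha'
        omega
      · rw [hrG_out a haX, hrG_in b hbX] at hab
        have := hle b hb'
        omega
      · rw [hrG_out a haX, hrG_out b hbX] at hab
        exact hr ha hb (by omega)
    have hcompatG : ∀ a ∈ T, ∀ a' ∈ T, rG a < rG a' →
        ∫ ω, F (openCluster ω a) ∂(prodBernoulli w) ≤ ∫ ω, F (openCluster ω a') ∂(prodBernoulli w) := by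
      intro a ha a' ha' hlt
      by_cases haX : a ∈ X <;> by_cases ha'X : a' ∈ X
      · rw [hrG_in a haX, hrG_in a' ha'X] at hlt
        exact hcompat a ha a' ha' hlt
      · exact (hA a haX).trans (hmx a' ha')
      · rw [hrG_out a haX, hrG_in a' ha'X] at hlt
        have := hle a' ha'
        omega
      · rw [hrG_out a haX, hrG_out a' ha'X] at hlt
        exact hcompat a ha a' ha' (by omega)
    have hinv : ∀ t ∈ T, t ∉ X → ∀ g ∈ X, g ∈ T ∧ rG g < rG t := by
      intro t ht htX g hg
      refine ⟨hXT g hg, ?_⟩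
      rw [hrG_in g hg, hrG_out t htX]
      have := hle g (hXT g hg)
      omega
    have hposG : 0 < s5dMargin w T rG [] o v F := by
      rw [← s5dMargin_nil_eq_of_compat w T r rG o v F hr hrG hcompat hcompatG]; exact hpos
    refine ⟨rG, hrG, hcompatG, ?_⟩
    exact floor_pos_of_gatesFirst w E hE0 hE1 o v hov K hoK hvK hKconn X hKexit hXadj T rG [] F hrG hoT hvT hTK List.nodup_nil
      (fun d hd => absurd hd List.not_mem_nil) (fun d hd => absurd hd List.not_mem_nil) hF hF0 hcompatG hinv hposG

/-- **ROW M2-R30 AS TYPED, for every monotone nonnegative `F` and every compatible injective rank.**  Weights non-degenerate on the support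
`E`, in which every relay is joined to the minimal relay `x₁`; `o ≠ v` off `T`; `r` injective on `T`, compatible with the means of `F`.  Then
`0 < s5dMargin w T r [] o v F ↔ ∃ r'` injective on `T`, `m(F)`-compatible, with `0 < FLOOR_F(r')`.
[cite: KozmaNitzan2024, Conj. 4 (p. 32)] [cite: Harris1960, Lemma 4.1 (p. 16)] -/
theorem s5dMargin_nil_pos_iff_exists_compat_rank_floor_pos_general (w : Sym2 (Fin n) → unitInterval) (E : Set (Sym2 (Fin n)))
    (hE0 : ∀ f, f ∉ E → (w f : ℝ) = 0) (hE1 : ∀ f ∈ E, 0 < (w f : ℝ) ∧ (w f : ℝ) < 1)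
    (T : Finset (Fin n)) (r : Fin n → ℕ) (hr : Set.InjOn r ↑T) (x₁ : Fin n) (hx : x₁ ∈ T) (hmin : ∀ t ∈ T, r x₁ ≤ r t)
    (hconn : ∀ b ∈ T, (openGraph E).Reachable b x₁)
    (o v : Fin n) (hoT : o ∉ T) (hvT : v ∉ T) (hov : o ≠ v)
    (F : Set (Fin n) → ℝ) (hF : ∀ S S' : Set (Fin n), S ⊆ S' → F S ≤ F S') (hF0 : ∀ S : Set (Fin n), 0 ≤ F S)
    (hcompat : ∀ a ∈ T, ∀ a' ∈ T, r a < r a' →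
      ∫ ω, F (openCluster ω a) ∂(prodBernoulli w) ≤ ∫ ω, F (openCluster ω a') ∂(prodBernoulli w)) :
    0 < s5dMargin w T r [] o v F ↔
      ∃ r' : Fin n → ℕ, Set.InjOn r' ↑T ∧
        (∀ a ∈ T, ∀ a' ∈ T, r' a < r' a' →
          ∫ ω, F (openCluster ω a) ∂(prodBernoulli w) ≤ ∫ ω, F (openCluster ω a') ∂(prodBernoulli w)) ∧
        0 < ∑ a ∈ T, (rankGain w T r' F a * avoidConst w a ((↑(T.erase a) : Set (Fin n)) ∪ ({d | d ∈ ([] : List (Fin n))} ∪ {v})) o +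
        (∏ e ∈ Finset.univ.filter (fun e : Sym2 (Fin n) => ∃ y ∈ (↑(T.filter (fun b => r' b < r' a)) : Set (Fin n)), y ∈ e), (1 - (w e : ℝ))) *
          ((∫ η in ((⋃ t ∈ (insert a (T.filter (fun b => r' a < r' b) ∪ (([] : List (Fin n))).toFinset)), openConn o t) ∪ openConn o v),
              F {c | c = a ∨ ∃ e ∈ openEdgeCluster η a, c ∈ e}
              ∂(prodBernoulli fun e => if (∃ y ∈ (↑(T.filter (fun b => r' b < r' a)) : Set (Fin n)), y ∈ e) then (0 : unitInterval) else w e)) -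
            (prodBernoulli fun e => if (∃ y ∈ (↑(T.filter (fun b => r' b < r' a)) : Set (Fin n)), y ∈ e) then (0 : unitInterval) else w e).real
                ((⋃ t ∈ (insert a (T.filter (fun b => r' a < r' b) ∪ (([] : List (Fin n))).toFinset)), openConn o t) ∪ openConn o v) *
              (∫ η, F {c | c = a ∨ ∃ e ∈ openEdgeCluster η a, c ∈ e}
                ∂(prodBernoulli fun e => if (∃ y ∈ (↑(T.filter (fun b => r' b < r' a)) : Set (Fin n)), y ∈ e) then (0 : unitInterval) else w e)))) := by
  have hw1r : ∀ e, (w e : ℝ) < 1 := by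
    intro e
    by_cases he : e ∈ E
    · exact (hE1 e he).2
    · rw [hE0 e he]; norm_num
  have hw : ∀ e, w e < 1 := fun e => by
    have h := hw1r e
    exact Subtype.coe_lt_coe.1 (by simpa using h)
  constructor
  · exact exists_compat_rank_floor_pos w E hE0 hE1 T r hr x₁ hx hmin hconn o v hoT hvT hov F hF hF0 hcompat
  · rintro ⟨r', hr', hcompat', hfloor⟩
    have hle := s5dMargin_ge_sum_rankGain_add_isolatedFloor_of_lt_one_of_compat w hw o v hov T r' F hF hF0 hr' hcompat' hoT hvT
    rw [s5dMargin_nil_eq_of_compat w T r r' o v F hr hr' hcompat hcompat']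
    exact lt_of_lt_of_le hfloor hle

/-- **ROW M2-R30 AS TYPED on a preconnected support** (packaging of `…_general`: `T ≠ ∅`, the minimal relay exists and every relay is joined to
it). [cite: KozmaNitzan2024, Conj. 4 (p. 32)] -/
theorem s5dMargin_nil_pos_iff_exists_compat_rank_floor_pos_of_preconnected (w : Sym2 (Fin n) → unitInterval) (E : Set (Sym2 (Fin n)))
    (hE0 : ∀ f, f ∉ E → (w f : ℝ) = 0) (hE1 : ∀ f ∈ E, 0 < (w f : ℝ) ∧ (w f : ℝ) < 1) (hconn : (openGraph E).Preconnected)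
    (o v : Fin n) (hov : o ≠ v) (T : Finset (Fin n)) (hT : T.Nonempty) (r : Fin n → ℕ) (hr : Set.InjOn r ↑T)
    (F : Set (Fin n) → ℝ) (hF : ∀ S S' : Set (Fin n), S ⊆ S' → F S ≤ F S') (hF0 : ∀ S : Set (Fin n), 0 ≤ F S)
    (hcompat : ∀ a ∈ T, ∀ a' ∈ T, r a < r a' →
      ∫ ω, F (openCluster ω a) ∂(prodBernoulli w) ≤ ∫ ω, F (openCluster ω a') ∂(prodBernoulli w))
    (hoT : o ∉ T) (hvT : v ∉ T) :
    0 < s5dMargin w T r [] o v F ↔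
      ∃ r' : Fin n → ℕ, Set.InjOn r' ↑T ∧
        (∀ a ∈ T, ∀ a' ∈ T, r' a < r' a' →
          ∫ ω, F (openCluster ω a) ∂(prodBernoulli w) ≤ ∫ ω, F (openCluster ω a') ∂(prodBernoulli w)) ∧
        0 < ∑ a ∈ T, (rankGain w T r' F a * avoidConst w a ((↑(T.erase a) : Set (Fin n)) ∪ ({d | d ∈ ([] : List (Fin n))} ∪ {v})) o +
        (∏ e ∈ Finset.univ.filter (fun e : Sym2 (Fin n) => ∃ y ∈ (↑(T.filter (fun b => r' b < r' a)) : Set (Fin n)), y ∈ e), (1 - (w e : ℝ))) *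
          ((∫ η in ((⋃ t ∈ (insert a (T.filter (fun b => r' a < r' b) ∪ (([] : List (Fin n))).toFinset)), openConn o t) ∪ openConn o v),
              F {c | c = a ∨ ∃ e ∈ openEdgeCluster η a, c ∈ e}
              ∂(prodBernoulli fun e => if (∃ y ∈ (↑(T.filter (fun b => r' b < r' a)) : Set (Fin n)), y ∈ e) then (0 : unitInterval) else w e)) -
            (prodBernoulli fun e => if (∃ y ∈ (↑(T.filter (fun b => r' b < r' a)) : Set (Fin n)), y ∈ e) then (0 : unitInterval) else w e).real
                ((⋃ t ∈ (insert a (T.filter (fun b => r' a < r' b) ∪ (([] : List (Fin n))).toFinset)), openConn o t) ∪ openConn o v) *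
              (∫ η, F {c | c = a ∨ ∃ e ∈ openEdgeCluster η a, c ∈ e}
                ∂(prodBernoulli fun e => if (∃ y ∈ (↑(T.filter (fun b => r' b < r' a)) : Set (Fin n)), y ∈ e) then (0 : unitInterval) else w e)))) := by
  obtain ⟨x₁, hx, hmin⟩ := Finset.exists_min_image T r hT
  exact s5dMargin_nil_pos_iff_exists_compat_rank_floor_pos_general w E hE0 hE1 T r hr x₁ hx hmin (fun b _ => hconn b x₁) o v hoT hvT hov
    F hF hF0 hcompat

/-- **The general-`F` ZERO SET of (S5)** (preconnected non-degenerate support, compatible injective rank, `F` monotone `≥ 0`):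
`s5dMargin w T r [] o v F = 0 ↔ FLOOR_F(r') = 0 for EVERY compatible injective rank `r'`** — equivalently (by the mechanism of
`CSH.exists_compat_rank_floor_pos`) every gate of the observer's pocket has the minimal mean and the floor vanishes at the gates-first rank.
[cite: KozmaNitzan2024, Conj. 4 (p. 32)] [cite: Harris1960, Lemma 4.1 (p. 16)] -/
theorem s5dMargin_nil_eq_zero_iff_forall_compat_rank_floor_eq_zero (w : Sym2 (Fin n) → unitInterval) (E : Set (Sym2 (Fin n)))
    (hE0 : ∀ f, f ∉ E → (w f : ℝ) = 0) (hE1 : ∀ f ∈ E, 0 < (w f : ℝ) ∧ (w f : ℝ) < 1) (hconn : (openGraph E).Preconnected)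
    (o v : Fin n) (hov : o ≠ v) (T : Finset (Fin n)) (hT : T.Nonempty) (r : Fin n → ℕ) (hr : Set.InjOn r ↑T)
    (F : Set (Fin n) → ℝ) (hF : ∀ S S' : Set (Fin n), S ⊆ S' → F S ≤ F S') (hF0 : ∀ S : Set (Fin n), 0 ≤ F S)
    (hcompat : ∀ a ∈ T, ∀ a' ∈ T, r a < r a' →
      ∫ ω, F (openCluster ω a) ∂(prodBernoulli w) ≤ ∫ ω, F (openCluster ω a') ∂(prodBernoulli w))
    (hoT : o ∉ T) (hvT : v ∉ T) :
    s5dMargin w T r [] o v F = 0 ↔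
      ∀ r' : Fin n → ℕ, Set.InjOn r' ↑T →
        (∀ a ∈ T, ∀ a' ∈ T, r' a < r' a' →
          ∫ ω, F (openCluster ω a) ∂(prodBernoulli w) ≤ ∫ ω, F (openCluster ω a') ∂(prodBernoulli w)) →
        ∑ a ∈ T, (rankGain w T r' F a * avoidConst w a ((↑(T.erase a) : Set (Fin n)) ∪ ({d | d ∈ ([] : List (Fin n))} ∪ {v})) o +
        (∏ e ∈ Finset.univ.filter (fun e : Sym2 (Fin n) => ∃ y ∈ (↑(T.filter (fun b => r' b < r' a)) : Set (Fin n)), y ∈ e), (1 - (w e : ℝ))) *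
          ((∫ η in ((⋃ t ∈ (insert a (T.filter (fun b => r' a < r' b) ∪ (([] : List (Fin n))).toFinset)), openConn o t) ∪ openConn o v),
              F {c | c = a ∨ ∃ e ∈ openEdgeCluster η a, c ∈ e}
              ∂(prodBernoulli fun e => if (∃ y ∈ (↑(T.filter (fun b => r' b < r' a)) : Set (Fin n)), y ∈ e) then (0 : unitInterval) else w e)) -
            (prodBernoulli fun e => if (∃ y ∈ (↑(T.filter (fun b => r' b < r' a)) : Set (Fin n)), y ∈ e) then (0 : unitInterval) else w e).real
                ((⋃ t ∈ (insert a (T.filter (fun b => r' a < r' b) ∪ (([] : List (Fin n))).toFinset)), openConn o t) ∪ openConn o v) *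
              (∫ η, F {c | c = a ∨ ∃ e ∈ openEdgeCluster η a, c ∈ e}
                ∂(prodBernoulli fun e => if (∃ y ∈ (↑(T.filter (fun b => r' b < r' a)) : Set (Fin n)), y ∈ e) then (0 : unitInterval) else w e)))) = 0 := by
  have hw1r : ∀ e, (w e : ℝ) < 1 := by
    intro e
    by_cases he : e ∈ E
    · exact (hE1 e he).2
    · rw [hE0 e he]; norm_num
  have hw : ∀ e, w e < 1 := fun e => by
    have h := hw1r e
    exact Subtype.coe_lt_coe.1 (by simpa using h)
  have hiff := s5dMargin_nil_pos_iff_exists_compat_rank_floor_pos_of_preconnected w E hE0 hE1 hconn o v hov T hT r hr F hF hF0 hcompat hoT hvT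
  -- the floor is nonnegative and dominated by the margin at every compatible rank
  have hfl : ∀ r' : Fin n → ℕ, Set.InjOn r' ↑T →
      (∀ a ∈ T, ∀ a' ∈ T, r' a < r' a' →
        ∫ ω, F (openCluster ω a) ∂(prodBernoulli w) ≤ ∫ ω, F (openCluster ω a') ∂(prodBernoulli w)) →
      0 ≤ ∑ a ∈ T, (rankGain w T r' F a * avoidConst w a ((↑(T.erase a) : Set (Fin n)) ∪ ({d | d ∈ ([] : List (Fin n))} ∪ {v})) o +
        (∏ e ∈ Finset.univ.filter (fun e : Sym2 (Fin n) => ∃ y ∈ (↑(T.filter (fun b => r' b < r' a)) : Set (Fin n)), y ∈ e), (1 - (w e : ℝ))) *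
          ((∫ η in ((⋃ t ∈ (insert a (T.filter (fun b => r' a < r' b) ∪ (([] : List (Fin n))).toFinset)), openConn o t) ∪ openConn o v),
              F {c | c = a ∨ ∃ e ∈ openEdgeCluster η a, c ∈ e}
              ∂(prodBernoulli fun e => if (∃ y ∈ (↑(T.filter (fun b => r' b < r' a)) : Set (Fin n)), y ∈ e) then (0 : unitInterval) else w e)) -
            (prodBernoulli fun e => if (∃ y ∈ (↑(T.filter (fun b => r' b < r' a)) : Set (Fin n)), y ∈ e) then (0 : unitInterval) else w e).real
                ((⋃ t ∈ (insert a (T.filter (fun b => r' a < r' b) ∪ (([] : List (Fin n))).toFinset)), openConn o t) ∪ openConn o v) *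
              (∫ η, F {c | c = a ∨ ∃ e ∈ openEdgeCluster η a, c ∈ e}
                ∂(prodBernoulli fun e => if (∃ y ∈ (↑(T.filter (fun b => r' b < r' a)) : Set (Fin n)), y ∈ e) then (0 : unitInterval) else w e)))) ∧ ∑ a ∈ T, (rankGain w T r' F a * avoidConst w a ((↑(T.erase a) : Set (Fin n)) ∪ ({d | d ∈ ([] : List (Fin n))} ∪ {v})) o +
        (∏ e ∈ Finset.univ.filter (fun e : Sym2 (Fin n) => ∃ y ∈ (↑(T.filter (fun b => r' b < r' a)) : Set (Fin n)), y ∈ e), (1 - (w e : ℝ))) *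
          ((∫ η in ((⋃ t ∈ (insert a (T.filter (fun b => r' a < r' b) ∪ (([] : List (Fin n))).toFinset)), openConn o t) ∪ openConn o v),
              F {c | c = a ∨ ∃ e ∈ openEdgeCluster η a, c ∈ e}
              ∂(prodBernoulli fun e => if (∃ y ∈ (↑(T.filter (fun b => r' b < r' a)) : Set (Fin n)), y ∈ e) then (0 : unitInterval) else w e)) -
            (prodBernoulli fun e => if (∃ y ∈ (↑(T.filter (fun b => r' b < r' a)) : Set (Fin n)), y ∈ e) then (0 : unitInterval) else w e).real
                ((⋃ t ∈ (insert a (T.filter (fun b => r' a < r' b) ∪ (([] : List (Fin n))).toFinset)), openConn o t) ∪ openConn o v) *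
              (∫ η, F {c | c = a ∨ ∃ e ∈ openEdgeCluster η a, c ∈ e}
                ∂(prodBernoulli fun e => if (∃ y ∈ (↑(T.filter (fun b => r' b < r' a)) : Set (Fin n)), y ∈ e) then (0 : unitInterval) else w e)))) ≤ s5dMargin w T r [] o v F := by
    intro r' hr' hcompat'
    have hnn := fun a (ha : a ∈ T) => isolatedFloor_term_nonneg w o v T r' F hF hF0 hcompat' a ha
    refine ⟨Finset.sum_nonneg fun a ha => add_nonneg (hnn a ha).1 (hnn a ha).2, ?_⟩
    rw [s5dMargin_nil_eq_of_compat w T r r' o v F hr hr' hcompat hcompat']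
    exact s5dMargin_ge_sum_rankGain_add_isolatedFloor_of_lt_one_of_compat w hw o v hov T r' F hF hF0 hr' hcompat' hoT hvT
  constructor
  · intro h0 r' hr' hcompat'
    obtain ⟨h1, h2⟩ := hfl r' hr' hcompat'
    rw [h0] at h2
    exact le_antisymm h2 h1
  · intro hall
    obtain ⟨h1, h2⟩ := hfl r hr hcompat
    rcases (h1.trans h2).lt_or_eq with hlt | heq
    · obtain ⟨r', hr', hcompat', hpos⟩ := hiff.1 hlt
      rw [hall r' hr' hcompat'] at hpos
      exact absurd hpos (lt_irrefl 0)
    · exact heq.symm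

end CSH

end Summit.CriticalPhenomena.PercolationContinuityZ3.Theorems

end
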